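import Literature.NumberTheory.Automorphic.ArchTorusWeylAction           -- ★ p06 (g9): `det_monomial_one_ne_zero`, `monomial_conj_circleDiagonal` (`M(σ)·diag z·M(σ)⁻¹ = diag (z ∘ σ⁻¹)`)
import Literature.NumberTheory.Automorphic.UnitaryGroupFormTransport     -- ★ `formCongr`, `unitaryGroupOfFormCongrOfEq` (`g ↦ T g T⁻¹`), `coe_unitaryGroupOfFormCongrOfEq_apply`
import Literature.NumberTheory.Automorphic.UnitaryGroupArchimedeanPlaces -- ★ `archLocal`
import Mathlib.MeasureTheory.Group.Measure
import Mathlib.MeasureTheory.Integral.Bochner.Basic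
import Mathlib.Analysis.Calculus.ContDiff.Operations
import HarnessLib

/-!
# Relabelling transport between the archimedean unitary groups `U(σ_w diag α)(ℂ)` and `U(σ_w diag (α ∘ σ))(ℂ)`:
# the permutation matrix `M(σ)` conjugates one onto the other, carrying torus points `diag z ↦ diag (z ∘ σ⁻¹)`,
# Haar measures to Haar measures and torus orbital integrals to torus orbital integrals
(ROAD-Sd junction prep J1-glue; Rogawski 1990 §8.2 p. 122 «the classes `γ, γ₁, γ₂`»; Bröcker–tom Dieck IV (3.2))

Topic `NumberTheory/Automorphic`; namespace `Literature.NumberTheory.Automorphic.UnitaryGroup`.  THEOREMS ONLY (no `def`, no instance,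
no notation, no axiom, no named fact, no `sorry`).  Cell `pub/hodgecm-mathlib`, ENGINE T1 (crux H413 = `stmt-HodgeConjecture-24833`); floor-1
preparation, count-neutral, under books rows #88 (ST-∞) ∕ #111 (S-d) (ROAD-Sd junction census `CENSUS-ROAD-Sd-JUNCTION` d13cf214, §2 row
«relabelling iso»; LEAD DESK WORD T8-23 (C)(3), F0P3a-plan (g9)); author F0P3a-p07 (g7).

WHY.  The per-place archimedean limit-formula letters (B5) `Rogawski1990/ArchLimitFormula` ((C-bdry), (J-nc)) and the ★ compact-wall theorems
(`ArchLocalTorusOrbitalCompactWall*`) are typed for the STANDARD one-angle curve `ψ ↦ diag(z₀₀e^{iψ}, z₀₁, z₀₀e^{−iψ})` at the `{0,2}`-wall of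
`G_w(α) = archLocal L 3 (diagonal α) w`.  The stable torus function is a sum over RELABELLED torus points `diag (z ∘ ρ)`, `ρ ∈ S₃`
(★ `archStableOrbitalIntegral_archDiagTorus_eq_inv_mul_sum_integral_conj`), whose one-angle curves live at the other walls.  A relabelling is NOT a
conjugation inside `G_w(α)` unless it preserves the sign pattern (★ `ArchTorusOrbitalWeyl`, `ArchTorusWeylAction`); it IS conjugation by the permutation
matrix `M(σ) = monomial σ 1` between the TWO groups `G_w(α ∘ σ)` and `G_w(α)` — an isomorphism of topological groups, the generic ★
`unitaryGroupOfFormCongrOfEq` at the congruence `M(σ)ᴴ · σ_w(diag α) · M(σ) = σ_w(diag (α ∘ σ))`.  This file records that transport in the torus currency, so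
that a statement proved for the standard curve on EVERY `G_w(α′)` applies to every relabelled curve on `G_w(α)` (with `α′ = α ∘ σ`).

WHAT IS PROVED (`L` any field with a complex place `w`, any `N`, any `σ : Perm (Fin N)`; `M(σ) := GeneralLinearGroup.mkOfDetNeZero (monomial σ 1) _`;
the iso is the TERM `ContinuousMulEquiv.restrictSubgroup (GLn.conjEquiv M(σ)) (G_w(α ∘ σ)) (G_w(α)) (mem_archLocal_comp_perm_iff_conj_mem …) :
G_w(α ∘ σ) ≃ₜ* G_w(α)` (★ `ContinuousMulEquiv.restrictSubgroup`, ★ `GLn.conjEquiv`; = ★ `unitaryGroupOfFormCongrOfEq` at the congruence, with the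
carriers spelled `archLocal …` so that instances on `archLocal` are found) — no new definition; below `e_σ` for short):
* §1 `formCongr_monomialGL_map_diagonal` — the congruence `formCongr conj M(σ) (σ_w diag α) = σ_w diag (α ∘ σ)`; `mem_archLocal_comp_perm_iff_conj_mem`
  (`g ∈ G_w(α ∘ σ) ↔ M(σ) g M(σ)⁻¹ ∈ G_w(α)`, ★ `conj_mem_unitaryGroupOfForm_iff`); `coe_relabel_apply` (`e_σ g = M(σ) g M(σ)⁻¹`,
  `rfl`), **`relabel_circleDiagonal`** (`e_σ (diag z) = diag (z ∘ σ⁻¹)`), `relabel_conj_circleDiagonal` (`e_σ (g · diag z · g⁻¹) = e_σ g · diag (z ∘ σ⁻¹) · (e_σ g)⁻¹`).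
* §2 measures: `isMulRightInvariant_map_relabel_symm` (right invariance is transported; Haar-ness is Mathlib's instance `ContinuousMulEquiv.isHaarMeasure_map`),
  **`integral_comp_conj_circleDiagonal_comp_perm_eq_integral_map_relabel`** — THE TRANSPORT OF THE TORUS ORBITAL INTEGRAL:
  `∫_{G_w(α)} f(g · diag(z ∘ σ⁻¹) · g⁻¹) dν(g) = ∫_{G_w(α∘σ)} f(e_σ(g′ · diag z · g′⁻¹)) d(e_σ⁻¹)_*ν (g′)` (Mathlib `integral_map_equiv` along the homeomorphism).
* §3 the ambient test-function currency: `apply_coe_relabel` (`Θ ↑↑(e_σ x) = Θ (M(σ) · ↑↑x · M(σ)⁻¹)`), `contDiff_comp_monomial_conj` (the transported ambient function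
  `A ↦ Θ (M(σ) A M(σ)⁻¹)` is as smooth as `Θ`), `hasCompactSupport_comp_relabel` (compact support on the group is kept), and the combination
  **`integral_comp_conj_circleDiagonal_comp_perm_eq_integral_ambient`**: `∫_{G_w(α)} Θ ↑↑(g · diag(z ∘ σ⁻¹) · g⁻¹) dν = ∫_{G_w(α∘σ)} Θ_σ ↑↑(g′ · diag z · g′⁻¹) d(e_σ⁻¹)_*ν`
  with `Θ_σ A = Θ (M(σ) A M(σ)⁻¹)` — the shape in which (J-nc)∕(J-cw) on `G_w(α ∘ σ)` are read back on `G_w(α)`.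
NOT HERE: the transport of `descConj`∕`quotientMeasure` (singular orbital integrals) along `e_σ` — ★ `InvariantQuotientTransport` ∕ `InvariantQuotientOrbitalTransport`
by name when a consumer wants the singular terms on `G_w(α)`; the `N = 3` wall bookkeeping (J1 file `Rogawski1990/ArchStableTorusOrbitalWallDeriv`).
HONEST LABEL: HC_CM is proved only modulo the printed citations until rung 0 closes; this file is bookkeeping and pays nothing by itself.

## References
* [Rogawski1990] J. D. Rogawski, *Automorphic Representations of Unitary Groups in Three Variables*, Ann. of Math. Stud. 123 (1990), §8.2 p. 122 (the relabelled
  torus points `γ, γ₁, γ₂` of a regular stable class), §3.1 p. 19.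
* [BrockerTomDieck1985] Th. Bröcker, T. tom Dieck, *Representations of Compact Lie Groups*, GTM 98 (1985), IV (3.2) (permutation ∕ monomial matrices act on the
  diagonal torus by relabelling).
* [PlatonovRapinchuk1994] V. Platonov, A. Rapinchuk, *Algebraic Groups and Number Theory* (1994), §2.3 (congruent forms have conjugate unitary groups).
* [Folland1995] G. B. Folland, *A Course in Abstract Harmonic Analysis* (1995), (2.52) (transport of Haar integrals along isomorphisms).
-/

set_option autoImplicit false

noncomputable section

open MeasureTheory Measure Matrix Equiv NumberField NumberField.InfinitePlace Filter Topology
open Literature.LinearAlgebra.Matrix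
open scoped MatrixGroups ComplexConjugate
open scoped Matrix.Norms.Operator

namespace Literature.NumberTheory.Automorphic.UnitaryGroup

/-! ## §1 The congruence and the relabelling isomorphism -/

section Algebra

variable (L : Type) [Field L] (N : ℕ) (α : Fin N → L) (w : {w : InfinitePlace L // IsComplex w})

/-- **THE RELABELLING CONGRUENCE**: `M(σ)ᴴ · σ_w(diag α) · M(σ) = σ_w(diag (α ∘ σ))` for the permutation matrix `M(σ) = monomial σ 1`
(★ `conjTranspose_mul_diagonal_mul_monomial`), in the `formCongr` currency of ★ `UnitaryGroupFormTransport`. [cite: BrockerTomDieck1985, IV (3.2)] -/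
theorem formCongr_monomialGL_map_diagonal (σ : Perm (Fin N)) :
    formCongr (starRingEnd ℂ) (Matrix.GeneralLinearGroup.mkOfDetNeZero _ (det_monomial_one_ne_zero N σ))
        ((Matrix.diagonal α).map w.1.embedding) =
      (Matrix.diagonal (α ∘ σ)).map w.1.embedding := by
  rw [Matrix.diagonal_map (map_zero _), Matrix.diagonal_map (map_zero _)]
  have h : (((Matrix.GeneralLinearGroup.mkOfDetNeZero _ (det_monomial_one_ne_zero N σ) : GL (Fin N) ℂ) : Matrix (Fin N) (Fin N) ℂ).map
      (starRingEnd ℂ))ᵀ = (monomial σ fun _ : Fin N => (1 : ℂ))ᴴ := rfl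
  rw [formCongr, h, Matrix.GeneralLinearGroup.val_mkOfDetNeZero, conjTranspose_mul_diagonal_mul_monomial (fun _ => by simp)]
  rfl

/-- **`g ∈ G_w(α ∘ σ) ↔ M(σ) g M(σ)⁻¹ ∈ G_w(α)`** (★ `conj_mem_unitaryGroupOfForm_iff` at the relabelling congruence): the hypothesis of ★
`ContinuousMulEquiv.restrictSubgroup` that makes `GLn.conjEquiv M(σ)` restrict to `e_σ : G_w(α ∘ σ) ≃ₜ* G_w(α)`. [cite: PlatonovRapinchuk1994, §2.3] -/
theorem mem_archLocal_comp_perm_iff_conj_mem (σ : Perm (Fin N)) (g : GL (Fin N) ℂ) :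
    g ∈ archLocal L N (Matrix.diagonal (α ∘ σ)) w ↔
      GLn.conjEquiv (Matrix.GeneralLinearGroup.mkOfDetNeZero _ (det_monomial_one_ne_zero N σ)) g ∈ archLocal L N (Matrix.diagonal α) w := by
  rw [GLn.conjEquiv_apply]
  show g ∈ unitaryGroupOfForm (starRingEnd ℂ) ((Matrix.diagonal (α ∘ σ)).map w.1.embedding) ↔
    _ ∈ unitaryGroupOfForm (starRingEnd ℂ) ((Matrix.diagonal α).map w.1.embedding)
  rw [conj_mem_unitaryGroupOfForm_iff, formCongr_monomialGL_map_diagonal]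

/-- The relabelling isomorphism `e_σ : G_w(α ∘ σ) ≃ₜ* G_w(α)` (★ `GLn.conjEquiv M(σ)` restricted; = ★ `unitaryGroupOfFormCongrOfEq` at the relabelling congruence) acts by
`g ↦ M(σ) g M(σ)⁻¹` (definitional). [cite: PlatonovRapinchuk1994, §2.3] -/
theorem coe_relabel_apply (σ : Perm (Fin N)) (g : archLocal L N (Matrix.diagonal (α ∘ σ)) w) :
    (((ContinuousMulEquiv.restrictSubgroup (GLn.conjEquiv (Matrix.GeneralLinearGroup.mkOfDetNeZero _ (det_monomial_one_ne_zero N σ)))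
        (archLocal L N (Matrix.diagonal (α ∘ σ)) w) (archLocal L N (Matrix.diagonal α) w) (mem_archLocal_comp_perm_iff_conj_mem L N α w σ)) g : archLocal L N (Matrix.diagonal α) w) : GL (Fin N) ℂ) =
      Matrix.GeneralLinearGroup.mkOfDetNeZero _ (det_monomial_one_ne_zero N σ) * (g : GL (Fin N) ℂ) *
        (Matrix.GeneralLinearGroup.mkOfDetNeZero _ (det_monomial_one_ne_zero N σ))⁻¹ :=
  rfl

/-- **TORUS POINTS ARE RELABELLED**: `e_σ (diag z) = diag (z ∘ σ⁻¹)` (★ `monomial_conj_circleDiagonal`). [cite: BrockerTomDieck1985, IV (3.2)]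
[cite: Rogawski1990, §8.2 p. 122] -/
theorem relabel_circleDiagonal (σ : Perm (Fin N)) (z : Fin N → Circle) :
    (ContinuousMulEquiv.restrictSubgroup (GLn.conjEquiv (Matrix.GeneralLinearGroup.mkOfDetNeZero _ (det_monomial_one_ne_zero N σ)))
        (archLocal L N (Matrix.diagonal (α ∘ σ)) w) (archLocal L N (Matrix.diagonal α) w) (mem_archLocal_comp_perm_iff_conj_mem L N α w σ))
        ⟨circleDiagonal N z, circleDiagonal_mem_archLocal_diagonal L N (α ∘ σ) w z⟩ =
      ⟨circleDiagonal N (fun i => z (σ.symm i)), circleDiagonal_mem_archLocal_diagonal L N α w _⟩ := by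
  apply Subtype.ext
  rw [coe_relabel_apply]
  exact monomial_conj_circleDiagonal N σ z

/-- `e_σ (g · diag z · g⁻¹) = e_σ g · diag (z ∘ σ⁻¹) · (e_σ g)⁻¹` (multiplicativity + the previous lemma). [cite: Rogawski1990, §8.2 p. 122] -/
theorem relabel_conj_circleDiagonal (σ : Perm (Fin N)) (g : archLocal L N (Matrix.diagonal (α ∘ σ)) w) (z : Fin N → Circle) :
    (ContinuousMulEquiv.restrictSubgroup (GLn.conjEquiv (Matrix.GeneralLinearGroup.mkOfDetNeZero _ (det_monomial_one_ne_zero N σ)))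
        (archLocal L N (Matrix.diagonal (α ∘ σ)) w) (archLocal L N (Matrix.diagonal α) w) (mem_archLocal_comp_perm_iff_conj_mem L N α w σ))
        (g * ⟨circleDiagonal N z, circleDiagonal_mem_archLocal_diagonal L N (α ∘ σ) w z⟩ * g⁻¹) =
      (ContinuousMulEquiv.restrictSubgroup (GLn.conjEquiv (Matrix.GeneralLinearGroup.mkOfDetNeZero _ (det_monomial_one_ne_zero N σ)))
        (archLocal L N (Matrix.diagonal (α ∘ σ)) w) (archLocal L N (Matrix.diagonal α) w) (mem_archLocal_comp_perm_iff_conj_mem L N α w σ)) g *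
        ⟨circleDiagonal N (fun i => z (σ.symm i)), circleDiagonal_mem_archLocal_diagonal L N α w _⟩ *
        ((ContinuousMulEquiv.restrictSubgroup (GLn.conjEquiv (Matrix.GeneralLinearGroup.mkOfDetNeZero _ (det_monomial_one_ne_zero N σ)))
        (archLocal L N (Matrix.diagonal (α ∘ σ)) w) (archLocal L N (Matrix.diagonal α) w) (mem_archLocal_comp_perm_iff_conj_mem L N α w σ)) g)⁻¹ := by
  rw [map_mul, map_mul, map_inv, relabel_circleDiagonal]

end Algebra

/-! ## §2 Measures and the torus orbital integral -/

section MeasureTransport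

variable (L : Type) [Field L] (N : ℕ) (α : Fin N → L) (w : {w : InfinitePlace L // IsComplex w}) (σ : Perm (Fin N))
  [MeasurableSpace (archLocal L N (Matrix.diagonal α) w)] [BorelSpace (archLocal L N (Matrix.diagonal α) w)]
  [MeasurableSpace (archLocal L N (Matrix.diagonal (α ∘ σ)) w)] [BorelSpace (archLocal L N (Matrix.diagonal (α ∘ σ)) w)]

/-- Right invariance is transported along an isomorphism of topological groups (here: the measure `(e⁻¹)_* ν` on the source of `e`). [cite: Folland1995, (2.52)] -/
theorem isMulRightInvariant_map_continuousMulEquiv {G H : Type*} [Group G] [Group H] [TopologicalSpace G] [TopologicalSpace H]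
    [IsTopologicalGroup G] [IsTopologicalGroup H] [MeasurableSpace G] [BorelSpace G] [MeasurableSpace H] [BorelSpace H]
    (e : G ≃ₜ* H) (ν : Measure G) [ν.IsMulRightInvariant] : (ν.map e).IsMulRightInvariant := by
  have hme : Measurable (fun x : G => e x) := e.continuous.measurable
  refine ⟨fun h => ?_⟩
  rw [map_map (measurable_mul_const h) hme]
  obtain ⟨g, rfl⟩ := e.surjective h
  conv_rhs => rw [← map_mul_right_eq_self ν g]
  rw [map_map hme (measurable_mul_const g)]
  congr 1
  ext x
  simp only [Function.comp_apply, map_mul]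

/-- `(e_σ⁻¹)_* ν` is right invariant if `ν` is. [cite: Folland1995, (2.52)] -/
theorem isMulRightInvariant_map_relabel_symm (ν : Measure (archLocal L N (Matrix.diagonal α) w)) [ν.IsMulRightInvariant] :
    (ν.map (ContinuousMulEquiv.restrictSubgroup (GLn.conjEquiv (Matrix.GeneralLinearGroup.mkOfDetNeZero _ (det_monomial_one_ne_zero N σ)))
        (archLocal L N (Matrix.diagonal (α ∘ σ)) w) (archLocal L N (Matrix.diagonal α) w) (mem_archLocal_comp_perm_iff_conj_mem L N α w σ)).symm).IsMulRightInvariant :=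
  isMulRightInvariant_map_continuousMulEquiv _ ν

/-- **TRANSPORT OF THE TORUS ORBITAL INTEGRAL ALONG THE RELABELLING**: for every `f` on `G_w(α)`, every measure `ν` on `G_w(α)` and every `z`,
`∫_{G_w(α)} f(g · diag(z ∘ σ⁻¹) · g⁻¹) dν(g) = ∫_{G_w(α∘σ)} f(e_σ(g′ · diag z · g′⁻¹)) d((e_σ⁻¹)_*ν)(g′)` (change of variables `g = e_σ g′` along the
homeomorphism, Mathlib `integral_map_equiv`, and `e_σ (diag z) = diag (z ∘ σ⁻¹)`). [cite: Folland1995, (2.52)] [cite: Rogawski1990, §8.2 p. 122] -/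
theorem integral_comp_conj_circleDiagonal_comp_perm_eq_integral_map_relabel {E : Type*} [NormedAddCommGroup E] [NormedSpace ℝ E]
    (ν : Measure (archLocal L N (Matrix.diagonal α) w)) (f : archLocal L N (Matrix.diagonal α) w → E) (z : Fin N → Circle) :
    ∫ g, f (g * ⟨circleDiagonal N (fun i => z (σ.symm i)), circleDiagonal_mem_archLocal_diagonal L N α w _⟩ * g⁻¹) ∂ν =
      ∫ g', f ((ContinuousMulEquiv.restrictSubgroup (GLn.conjEquiv (Matrix.GeneralLinearGroup.mkOfDetNeZero _ (det_monomial_one_ne_zero N σ)))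
        (archLocal L N (Matrix.diagonal (α ∘ σ)) w) (archLocal L N (Matrix.diagonal α) w) (mem_archLocal_comp_perm_iff_conj_mem L N α w σ))
          (g' * ⟨circleDiagonal N z, circleDiagonal_mem_archLocal_diagonal L N (α ∘ σ) w z⟩ * g'⁻¹))
        ∂(ν.map (ContinuousMulEquiv.restrictSubgroup (GLn.conjEquiv (Matrix.GeneralLinearGroup.mkOfDetNeZero _ (det_monomial_one_ne_zero N σ)))
        (archLocal L N (Matrix.diagonal (α ∘ σ)) w) (archLocal L N (Matrix.diagonal α) w) (mem_archLocal_comp_perm_iff_conj_mem L N α w σ)).symm) := by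
  set e := (ContinuousMulEquiv.restrictSubgroup (GLn.conjEquiv (Matrix.GeneralLinearGroup.mkOfDetNeZero _ (det_monomial_one_ne_zero N σ)))
        (archLocal L N (Matrix.diagonal (α ∘ σ)) w) (archLocal L N (Matrix.diagonal α) w) (mem_archLocal_comp_perm_iff_conj_mem L N α w σ)) with he
  have hmap : ν.map e.symm = ν.map e.symm.toHomeomorph.toMeasurableEquiv := rfl
  have hsym : ∀ g, e.symm.toHomeomorph.toMeasurableEquiv g = e.symm g := fun _ => rfl
  rw [hmap, integral_map_equiv]
  refine integral_congr_ae (Filter.Eventually.of_forall fun g => ?_)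
  dsimp only
  rw [hsym, relabel_conj_circleDiagonal, ← he, ContinuousMulEquiv.apply_symm_apply]

end MeasureTransport

/-! ## §3 The ambient test-function currency `Θ : M_N(ℂ) → E` -/

section Ambient

variable (L : Type) [Field L] (N : ℕ) (α : Fin N → L) (w : {w : InfinitePlace L // IsComplex w}) (σ : Perm (Fin N))

/-- On underlying matrices the relabelling iso is `A ↦ M(σ) A M(σ)⁻¹`: `Θ ↑↑(e_σ x) = Θ (M(σ) · ↑↑x · M(σ)⁻¹)`. [cite: BrockerTomDieck1985, IV (3.2)] -/
theorem apply_coe_relabel {E : Type*} (Θ : Matrix (Fin N) (Fin N) ℂ → E) (x : archLocal L N (Matrix.diagonal (α ∘ σ)) w) :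
    Θ ((((ContinuousMulEquiv.restrictSubgroup (GLn.conjEquiv (Matrix.GeneralLinearGroup.mkOfDetNeZero _ (det_monomial_one_ne_zero N σ)))
        (archLocal L N (Matrix.diagonal (α ∘ σ)) w) (archLocal L N (Matrix.diagonal α) w) (mem_archLocal_comp_perm_iff_conj_mem L N α w σ)) x : archLocal L N (Matrix.diagonal α) w) :
            GL (Fin N) ℂ) : Matrix (Fin N) (Fin N) ℂ) =
      Θ ((monomial σ fun _ : Fin N => (1 : ℂ)) * ((x : GL (Fin N) ℂ) : Matrix (Fin N) (Fin N) ℂ) *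
        (((Matrix.GeneralLinearGroup.mkOfDetNeZero _ (det_monomial_one_ne_zero N σ))⁻¹ : GL (Fin N) ℂ) : Matrix (Fin N) (Fin N) ℂ)) := by
  rw [coe_relabel_apply, Units.val_mul, Units.val_mul, Matrix.GeneralLinearGroup.val_mkOfDetNeZero]

/-- The transported ambient function `A ↦ Θ (M(σ) A M(σ)⁻¹)` is `C^n` when `Θ` is (composition with a continuous linear map). [cite: BrockerTomDieck1985, IV (3.2)] -/
theorem contDiff_comp_monomial_conj {E : Type*} [NormedAddCommGroup E] [NormedSpace ℝ E] {n : WithTop ℕ∞}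
    (Θ : Matrix (Fin N) (Fin N) ℂ → E) (hΘ : ContDiff ℝ n Θ) :
    ContDiff ℝ n fun A : Matrix (Fin N) (Fin N) ℂ =>
      Θ ((monomial σ fun _ : Fin N => (1 : ℂ)) * A *
        (((Matrix.GeneralLinearGroup.mkOfDetNeZero _ (det_monomial_one_ne_zero N σ))⁻¹ : GL (Fin N) ℂ) : Matrix (Fin N) (Fin N) ℂ)) :=
  hΘ.comp ((contDiff_const.mul contDiff_id).mul contDiff_const)

/-- Compact support on the group is kept: if `x ↦ Θ ↑↑x` has compact support on `G_w(α)`, then `x′ ↦ Θ (M(σ) ↑↑x′ M(σ)⁻¹)` has compact support on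
`G_w(α ∘ σ)` (it is the pull-back along the homeomorphism `e_σ`). [cite: Folland1995, (2.52)] [cite: PlatonovRapinchuk1994, §2.3] -/
theorem hasCompactSupport_comp_relabel {E : Type*} [Zero E] [TopologicalSpace E] (Θ : Matrix (Fin N) (Fin N) ℂ → E)
    (hfc : HasCompactSupport fun k : archLocal L N (Matrix.diagonal α) w => Θ (((k : GL (Fin N) ℂ) : Matrix (Fin N) (Fin N) ℂ))) :
    HasCompactSupport fun k : archLocal L N (Matrix.diagonal (α ∘ σ)) w =>
      Θ ((monomial σ fun _ : Fin N => (1 : ℂ)) * ((k : GL (Fin N) ℂ) : Matrix (Fin N) (Fin N) ℂ) *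
        (((Matrix.GeneralLinearGroup.mkOfDetNeZero _ (det_monomial_one_ne_zero N σ))⁻¹ : GL (Fin N) ℂ) : Matrix (Fin N) (Fin N) ℂ)) := by
  have heq : (fun k : archLocal L N (Matrix.diagonal (α ∘ σ)) w =>
      Θ ((monomial σ fun _ : Fin N => (1 : ℂ)) * ((k : GL (Fin N) ℂ) : Matrix (Fin N) (Fin N) ℂ) *
        (((Matrix.GeneralLinearGroup.mkOfDetNeZero _ (det_monomial_one_ne_zero N σ))⁻¹ : GL (Fin N) ℂ) : Matrix (Fin N) (Fin N) ℂ))) =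
      (fun k : archLocal L N (Matrix.diagonal α) w => Θ (((k : GL (Fin N) ℂ) : Matrix (Fin N) (Fin N) ℂ))) ∘
        ((ContinuousMulEquiv.restrictSubgroup (GLn.conjEquiv (Matrix.GeneralLinearGroup.mkOfDetNeZero _ (det_monomial_one_ne_zero N σ)))
        (archLocal L N (Matrix.diagonal (α ∘ σ)) w) (archLocal L N (Matrix.diagonal α) w) (mem_archLocal_comp_perm_iff_conj_mem L N α w σ)).toHomeomorph) := by
    funext k
    exact (apply_coe_relabel L N α w σ Θ k).symm
  rw [heq]
  exact hfc.comp_homeomorph _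

variable [MeasurableSpace (archLocal L N (Matrix.diagonal α) w)] [BorelSpace (archLocal L N (Matrix.diagonal α) w)]
  [MeasurableSpace (archLocal L N (Matrix.diagonal (α ∘ σ)) w)] [BorelSpace (archLocal L N (Matrix.diagonal (α ∘ σ)) w)]

/-- **THE RELABELLED TORUS ORBITAL INTEGRAL IN NORMAL FORM**: for an ambient test function `Θ` and any measure `ν` on `G_w(α)`,
`∫_{G_w(α)} Θ ↑↑(g · diag(z ∘ σ⁻¹) · g⁻¹) dν(g) = ∫_{G_w(α∘σ)} Θ_σ ↑↑(g′ · diag z · g′⁻¹) d((e_σ⁻¹)_*ν)(g′)`, `Θ_σ A = Θ (M(σ) A M(σ)⁻¹)` — the torus orbital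
integral of `Θ` at the RELABELLED point of `G_w(α)` is the torus orbital integral of the transported function at the STANDARD point of `G_w(α ∘ σ)`
(so the standard-curve statements (J-nc), (J-cw), (C-cw) on `G_w(α ∘ σ)` read on every relabelled curve of `G_w(α)`). [cite: Rogawski1990, §8.2 p. 122]
[cite: Folland1995, (2.52)] -/
theorem integral_comp_conj_circleDiagonal_comp_perm_eq_integral_ambient {E : Type*} [NormedAddCommGroup E] [NormedSpace ℝ E]
    (ν : Measure (archLocal L N (Matrix.diagonal α) w)) (Θ : Matrix (Fin N) (Fin N) ℂ → E) (z : Fin N → Circle) :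
    ∫ g : archLocal L N (Matrix.diagonal α) w,
        Θ ((((g * ⟨circleDiagonal N (fun i => z (σ.symm i)), circleDiagonal_mem_archLocal_diagonal L N α w _⟩ * g⁻¹ :
          archLocal L N (Matrix.diagonal α) w) : GL (Fin N) ℂ) : Matrix (Fin N) (Fin N) ℂ)) ∂ν =
      ∫ g' : archLocal L N (Matrix.diagonal (α ∘ σ)) w,
        Θ ((monomial σ fun _ : Fin N => (1 : ℂ)) *
            ((((g' * ⟨circleDiagonal N z, circleDiagonal_mem_archLocal_diagonal L N (α ∘ σ) w z⟩ * g'⁻¹ :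
              archLocal L N (Matrix.diagonal (α ∘ σ)) w) : GL (Fin N) ℂ) : Matrix (Fin N) (Fin N) ℂ)) *
          (((Matrix.GeneralLinearGroup.mkOfDetNeZero _ (det_monomial_one_ne_zero N σ))⁻¹ : GL (Fin N) ℂ) : Matrix (Fin N) (Fin N) ℂ))
        ∂(ν.map (ContinuousMulEquiv.restrictSubgroup (GLn.conjEquiv (Matrix.GeneralLinearGroup.mkOfDetNeZero _ (det_monomial_one_ne_zero N σ)))
        (archLocal L N (Matrix.diagonal (α ∘ σ)) w) (archLocal L N (Matrix.diagonal α) w) (mem_archLocal_comp_perm_iff_conj_mem L N α w σ)).symm) := by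
  rw [integral_comp_conj_circleDiagonal_comp_perm_eq_integral_map_relabel L N α w σ ν
    (fun k : archLocal L N (Matrix.diagonal α) w => Θ (((k : GL (Fin N) ℂ) : Matrix (Fin N) (Fin N) ℂ))) z]
  refine integral_congr_ae (Filter.Eventually.of_forall fun g' => ?_)
  exact apply_coe_relabel L N α w σ Θ _

/-- The same with the relabelled point written `diag (z ∘ ρ)` (★ (j2)'s indexing `Σ_ρ ∫ a(g · t(z ∘ ρ) · g⁻¹)`): transport along `e_{ρ⁻¹} : G_w(α ∘ ρ⁻¹) ≃ₜ* G_w(α)`.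
[cite: Rogawski1990, §8.2 p. 122] [cite: Folland1995, (2.52)] -/
theorem integral_comp_conj_circleDiagonal_comp_perm_eq_integral_ambient' {E : Type*} [NormedAddCommGroup E] [NormedSpace ℝ E]
    (ρ : Perm (Fin N))
    [MeasurableSpace (archLocal L N (Matrix.diagonal (α ∘ ⇑ρ⁻¹)) w)] [BorelSpace (archLocal L N (Matrix.diagonal (α ∘ ⇑ρ⁻¹)) w)]
    (ν : Measure (archLocal L N (Matrix.diagonal α) w)) (Θ : Matrix (Fin N) (Fin N) ℂ → E) (z : Fin N → Circle) :
    ∫ g : archLocal L N (Matrix.diagonal α) w,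
        Θ ((((g * ⟨circleDiagonal N (z ∘ ρ), circleDiagonal_mem_archLocal_diagonal L N α w _⟩ * g⁻¹ :
          archLocal L N (Matrix.diagonal α) w) : GL (Fin N) ℂ) : Matrix (Fin N) (Fin N) ℂ)) ∂ν =
      ∫ g' : archLocal L N (Matrix.diagonal (α ∘ ⇑ρ⁻¹)) w,
        Θ ((monomial ρ⁻¹ fun _ : Fin N => (1 : ℂ)) *
            ((((g' * ⟨circleDiagonal N z, circleDiagonal_mem_archLocal_diagonal L N (α ∘ ⇑ρ⁻¹) w z⟩ * g'⁻¹ :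
              archLocal L N (Matrix.diagonal (α ∘ ⇑ρ⁻¹)) w) : GL (Fin N) ℂ) : Matrix (Fin N) (Fin N) ℂ)) *
          (((Matrix.GeneralLinearGroup.mkOfDetNeZero _ (det_monomial_one_ne_zero N ρ⁻¹))⁻¹ : GL (Fin N) ℂ) : Matrix (Fin N) (Fin N) ℂ))
        ∂(ν.map (ContinuousMulEquiv.restrictSubgroup (GLn.conjEquiv (Matrix.GeneralLinearGroup.mkOfDetNeZero _ (det_monomial_one_ne_zero N ρ⁻¹)))
          (archLocal L N (Matrix.diagonal (α ∘ ⇑ρ⁻¹)) w) (archLocal L N (Matrix.diagonal α) w)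
          (mem_archLocal_comp_perm_iff_conj_mem L N α w ρ⁻¹)).symm) :=
  integral_comp_conj_circleDiagonal_comp_perm_eq_integral_ambient L N α w ρ⁻¹ ν Θ z

end Ambient

end Literature.NumberTheory.Automorphic.UnitaryGroup

end
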